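import Mathlib
import Literature.Analysis.Convexity.AnisotropicPerimeterPolytopePrism
import HarnessLib

/-!
# The anisotropic perimeter of an axis-parallel box in `ℝ³`

Topic `Literature/Analysis/Convexity`; namespace `Literature.Analysis.Convexity`.

The box instance of the facet formula (`anisotropicPerimeter_iInter_halfSpace_lt_eq_facetSum`,
`AnisotropicPerimeterPolytopePrism.lean`): for a compact convex `K ∋ 0` and `a, b ∈ ℝ³` with
`a_t < b_t`,
`P_K({x | ∀ t, a_t < x_t < b_t}) = Σ_t (h_K(e_t) + h_K(−e_t)) · Π_{t' ≠ t} (b_{t'} − a_{t'})`,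
`h_K(ν) = sup_{y ∈ K} ⟪y, ν⟫`, `e_t = EuclideanSpace.single t 1` (`anisotropicPerimeter_box`):
the box is the open H-polytope of the six constraints `⟪e_t, x⟫ < b_t`, `⟪−e_t, x⟫ < −a_t`; the
facet prisms are boxes of height one over the faces, of volume `Π_{t' ≠ t} (b_{t'} − a_{t'})`.
[cite: Maggi2012, (20.2) p. 258 and Remark 20.3 (facet sums for polyhedral boundaries);
EvansGariepy2015, Thm 5.16 (Gauss–Green), polyhedral case]
-/

noncomputable section

namespace Literature.Analysis.Convexity

open _root_.MeasureTheory Set Finset Filter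
open scoped ENNReal NNReal Topology RealInnerProductSpace

/-! ## The six constraints of a box -/

/-- `⟪e_t, x⟫ = x_t`. [folklore] -/
private theorem inner_single_left_one (t : Fin 3) (x : EuclideanSpace ℝ (Fin 3)) :
    ⟪EuclideanSpace.single t (1 : ℝ), x⟫ = x t := by
  simp [EuclideanSpace.inner_single_left]

/-- the normal of a box constraint paired with `x`: `x_t` resp. `−x_t`. [folklore] -/
private theorem inner_boxPair (a b : EuclideanSpace ℝ (Fin 3)) (t : Fin 3) (s : Bool)
    (x : EuclideanSpace ℝ (Fin 3)) :
    ⟪((if s then (EuclideanSpace.single t (1 : ℝ), b t)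
      else (-EuclideanSpace.single t (1 : ℝ), -a t)) :
        EuclideanSpace ℝ (Fin 3) × ℝ).1, x⟫ = if s then x t else -x t := by
  cases s <;> simp [inner_single_left_one, inner_neg_left]

/-- the level of a box constraint: `b_t` resp. `−a_t`. [folklore] -/
private theorem boxPair_snd (a b : EuclideanSpace ℝ (Fin 3)) (t : Fin 3) (s : Bool) :
    ((if s then (EuclideanSpace.single t (1 : ℝ), b t)
      else (-EuclideanSpace.single t (1 : ℝ), -a t)) :
        EuclideanSpace ℝ (Fin 3) × ℝ).2 = if s then b t else -a t := by
  cases s <;> simp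

/-- box constraints have unit normals. [folklore] -/
private theorem norm_boxPair_fst (a b : EuclideanSpace ℝ (Fin 3)) (p : Fin 3 × Bool) :
    ‖((fun p : Fin 3 × Bool =>
        if p.2 then (EuclideanSpace.single p.1 (1 : ℝ), b p.1)
        else (-EuclideanSpace.single p.1 (1 : ℝ), -a p.1)) p).1‖ = 1 := by
  obtain ⟨t, s⟩ := p
  cases s <;> simp

/-- membership in the plane of a box constraint: `x_t = b_t` resp. `x_t = a_t`. [folklore] -/
private theorem mem_plane_boxPair (a b : EuclideanSpace ℝ (Fin 3)) (t : Fin 3) (s : Bool)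
    (x : EuclideanSpace ℝ (Fin 3)) :
    ⟪((if s then (EuclideanSpace.single t (1 : ℝ), b t)
      else (-EuclideanSpace.single t (1 : ℝ), -a t)) :
        EuclideanSpace ℝ (Fin 3) × ℝ).1, x⟫ = ((if s then (EuclideanSpace.single t (1 : ℝ), b t)
      else (-EuclideanSpace.single t (1 : ℝ), -a t)) :
        EuclideanSpace ℝ (Fin 3) × ℝ).2 ↔ x t = if s then b t else a t := by
  rw [inner_boxPair, boxPair_snd]
  cases s <;> simp [neg_inj]

/-- coordinates of `e_t`. [folklore] -/
private theorem single_apply_one (t t' : Fin 3) :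
    (EuclideanSpace.single t (1 : ℝ) : EuclideanSpace ℝ (Fin 3)) t' = if t' = t then 1 else 0 := by
  rw [← inner_single_left_one t' (EuclideanSpace.single t 1), EuclideanSpace.inner_single_right]
  simp [eq_comm]

/-- membership in the plane of a box constraint, pair form. [folklore] -/
private theorem mem_plane_boxPair' (a b : EuclideanSpace ℝ (Fin 3)) (p : Fin 3 × Bool)
    (x : EuclideanSpace ℝ (Fin 3)) :
    x ∈ {x : EuclideanSpace ℝ (Fin 3) | ⟪((fun p : Fin 3 × Bool =>
        if p.2 then (EuclideanSpace.single p.1 (1 : ℝ), b p.1)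
        else (-EuclideanSpace.single p.1 (1 : ℝ), -a p.1)) p).1, x⟫ = ((fun p : Fin 3 × Bool =>
        if p.2 then (EuclideanSpace.single p.1 (1 : ℝ), b p.1)
        else (-EuclideanSpace.single p.1 (1 : ℝ), -a p.1)) p).2} ↔
      x p.1 = (if p.2 then b p.1 else a p.1) := by
  obtain ⟨t, s⟩ := p
  rw [Set.mem_setOf_eq, mem_plane_boxPair]

/-- the two faces normal to `e_t` lie at different levels (`a_t < b_t`). [folklore] -/
private theorem boxLevel_ne {a b : EuclideanSpace ℝ (Fin 3)} (hab : ∀ t, a t < b t) (t : Fin 3)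
    {s s' : Bool} (hss : s ≠ s') : (if s then b t else a t) ≠ (if s' then b t else a t) := by
  have h := hab t
  cases s <;> cases s'
  · exact absurd rfl hss
  · simp only [Bool.false_eq_true, if_false, if_true]; exact h.ne
  · simp only [Bool.false_eq_true, if_false, if_true]; exact h.ne'
  · exact absurd rfl hss

/-- distinct constraint pairs have distinct planes (uses `a_t < b_t`). [folklore] -/
private theorem plane_boxPair_ne {a b : EuclideanSpace ℝ (Fin 3)} (hab : ∀ t, a t < b t)
    {p p' : Fin 3 × Bool} (hpp' : p ≠ p') :
    {x : EuclideanSpace ℝ (Fin 3) | ⟪((fun p : Fin 3 × Bool =>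
        if p.2 then (EuclideanSpace.single p.1 (1 : ℝ), b p.1)
        else (-EuclideanSpace.single p.1 (1 : ℝ), -a p.1)) p).1, x⟫ = ((fun p : Fin 3 × Bool =>
        if p.2 then (EuclideanSpace.single p.1 (1 : ℝ), b p.1)
        else (-EuclideanSpace.single p.1 (1 : ℝ), -a p.1)) p).2} ≠
      {x | ⟪((fun p : Fin 3 × Bool =>
        if p.2 then (EuclideanSpace.single p.1 (1 : ℝ), b p.1)
        else (-EuclideanSpace.single p.1 (1 : ℝ), -a p.1)) p').1, x⟫ = ((fun p : Fin 3 × Bool =>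
        if p.2 then (EuclideanSpace.single p.1 (1 : ℝ), b p.1)
        else (-EuclideanSpace.single p.1 (1 : ℝ), -a p.1)) p').2} := by
  obtain ⟨t, s⟩ := p
  obtain ⟨t', s'⟩ := p'
  intro heq
  have hmem : ∀ x : EuclideanSpace ℝ (Fin 3),
      x t = (if s then b t else a t) ↔ x t' = (if s' then b t' else a t') := by
    intro x
    rw [← mem_plane_boxPair' a b (t, s), ← mem_plane_boxPair' a b (t', s'), heq]
  by_cases htt : t = t'
  · subst htt
    have hss : s ≠ s' := fun h => hpp' (by rw [h])
    have hne := boxLevel_ne hab t hss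
    generalize hc : (if s then b t else a t) = c at hmem hne
    generalize hc' : (if s' then b t else a t) = c' at hmem hne
    -- the point `c • e_t` lies in the first plane, hence in the second: `c = c'`
    have hx := (hmem (c • EuclideanSpace.single t (1 : ℝ))).1 (by simp)
    simp only [PiLp.smul_apply, smul_eq_mul, single_apply_one, if_true, mul_one] at hx
    exact hne hx
  · generalize hc : (if s then b t else a t) = c at hmem
    generalize hc' : (if s' then b t' else a t') = c' at hmem
    -- the point `c • e_t + (c' + 1) • e_{t'}` lies in the first plane but not in the second
    have hx := (hmem (c • EuclideanSpace.single t (1 : ℝ) +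
      (c' + 1) • EuclideanSpace.single t' (1 : ℝ))).1 (by simp [htt])
    simp [Ne.symm htt] at hx

/-- the six constraint pairs are pairwise distinct. [folklore] -/
private theorem boxPair_injective {a b : EuclideanSpace ℝ (Fin 3)} (hab : ∀ t, a t < b t) :
    Function.Injective
      (fun p : Fin 3 × Bool =>
        if p.2 then (EuclideanSpace.single p.1 (1 : ℝ), b p.1)
        else (-EuclideanSpace.single p.1 (1 : ℝ), -a p.1)) := by
  intro p p' h
  by_contra hne
  exact plane_boxPair_ne hab hne (by rw [h])

/-- the open box as the H-polytope of its six constraints. [folklore] -/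
private theorem iInter_boxPair_eq (a b : EuclideanSpace ℝ (Fin 3)) :
    (⋂ q ∈ (Finset.univ.image
      (fun p : Fin 3 × Bool =>
        if p.2 then (EuclideanSpace.single p.1 (1 : ℝ), b p.1)
        else (-EuclideanSpace.single p.1 (1 : ℝ), -a p.1))),
        {x : EuclideanSpace ℝ (Fin 3) | ⟪q.1, x⟫ < q.2}) =
      {x | ∀ t, a t < x t ∧ x t < b t} := by
  classical
  rw [Finset.set_biInter_finset_image]
  ext x
  simp only [Finset.mem_univ, Set.iInter_true, Set.mem_iInter, Set.mem_setOf_eq, Prod.forall,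
    Bool.forall_bool, inner_boxPair, boxPair_snd]
  simp only [Bool.false_eq_true, if_false, if_true, neg_lt_neg_iff]

/-- the closed box as the closed H-polytope of the six constraints. [folklore] -/
private theorem iInter_boxPair_le_eq (a b : EuclideanSpace ℝ (Fin 3)) :
    (⋂ q ∈ (Finset.univ.image
      (fun p : Fin 3 × Bool =>
        if p.2 then (EuclideanSpace.single p.1 (1 : ℝ), b p.1)
        else (-EuclideanSpace.single p.1 (1 : ℝ), -a p.1))),
        {x : EuclideanSpace ℝ (Fin 3) | ⟪q.1, x⟫ ≤ q.2}) =
      {x | ∀ t, a t ≤ x t ∧ x t ≤ b t} := by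
  classical
  rw [Finset.set_biInter_finset_image]
  ext x
  simp only [Finset.mem_univ, Set.iInter_true, Set.mem_iInter, Set.mem_setOf_eq, Prod.forall,
    Bool.forall_bool, inner_boxPair, boxPair_snd]
  simp only [Bool.false_eq_true, if_false, if_true, neg_le_neg_iff]

/-- The volume of a closed coordinate box of `EuclideanSpace ℝ (Fin 3)`.
[cite: EvansGariepy2015, Thm 5.16 (Gauss–Green) — plumbing] -/
theorem volume_setOf_forall_le_le_three (lo hi : Fin 3 → ℝ) :
    volume {x : EuclideanSpace ℝ (Fin 3) | ∀ t, lo t ≤ x t ∧ x t ≤ hi t} =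
      ∏ t, ENNReal.ofReal (hi t - lo t) := by
  have h := (EuclideanSpace.volume_preserving_symm_measurableEquiv_toLp
    (Fin 3)).measure_preimage_equiv (Set.Icc lo hi)
  rw [Real.volume_Icc_pi] at h
  rw [← h]
  congr 1
  ext x
  simp [Set.mem_Icc, Pi.le_def, forall_and]

/-! ## The facet prisms of a box are boxes of height one -/

/-- coordinates of the normal of a box constraint. [folklore] -/
private theorem boxPair_fst_apply (a b : EuclideanSpace ℝ (Fin 3)) (t : Fin 3) (s : Bool)
    (t' : Fin 3) :
    ((if s then (EuclideanSpace.single t (1 : ℝ), b t)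
      else (-EuclideanSpace.single t (1 : ℝ), -a t)) :
        EuclideanSpace ℝ (Fin 3) × ℝ).1 t' = if t' = t then (if s then 1 else -1) else 0 := by
  by_cases h : t' = t
  · cases s <;> simp [h]
  · cases s <;> simp [h]

/-- side lengths of a facet prism of the box. [folklore] -/
private theorem prismHi_sub_prismLo (a b : EuclideanSpace ℝ (Fin 3)) (t : Fin 3) (s : Bool)
    (t' : Fin 3) :
    (if t' = t then (if s then b t + 1 else a t) else b t') -
      (if t' = t then (if s then b t else a t - 1) else a t') =
        if t' = t then 1 else b t' - a t' := by
  split_ifs <;> ring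

/-- the facet prism over the face `x_t = b_t` (`s = true`, direction `e_t`) resp. `x_t = a_t`
(`s = false`, direction `−e_t`) of the closed box is a box of height one. [folklore] -/
private theorem prism_boxPair_eq {a b : EuclideanSpace ℝ (Fin 3)} (hab : ∀ t, a t < b t) (t : Fin 3)
    (s : Bool) :
    {x : EuclideanSpace ℝ (Fin 3) |
        ∃ y ∈ {x : EuclideanSpace ℝ (Fin 3) | ∀ t, a t ≤ x t ∧ x t ≤ b t} ∩
          {x | ⟪((if s then (EuclideanSpace.single t (1 : ℝ), b t)
      else (-EuclideanSpace.single t (1 : ℝ), -a t)) :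
        EuclideanSpace ℝ (Fin 3) × ℝ).1, x⟫ = ((if s then (EuclideanSpace.single t (1 : ℝ), b t)
      else (-EuclideanSpace.single t (1 : ℝ), -a t)) :
        EuclideanSpace ℝ (Fin 3) × ℝ).2},
        ∃ r ∈ Set.Icc (0 : ℝ) 1, x = y + r • ((if s then (EuclideanSpace.single t (1 : ℝ), b t)
      else (-EuclideanSpace.single t (1 : ℝ), -a t)) :
        EuclideanSpace ℝ (Fin 3) × ℝ).1} =
      {x | ∀ t', (if t' = t then (if s then b t else a t - 1) else a t') ≤ x t' ∧
        x t' ≤ (if t' = t then (if s then b t + 1 else a t) else b t')} := by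
  have hcoord : ∀ (y : EuclideanSpace ℝ (Fin 3)) (r : ℝ) (t' : Fin 3),
      (y + r • ((if s then (EuclideanSpace.single t (1 : ℝ), b t)
      else (-EuclideanSpace.single t (1 : ℝ), -a t)) :
        EuclideanSpace ℝ (Fin 3) × ℝ).1) t' =
        y t' + r * (if t' = t then (if s then 1 else -1) else 0) := by
    intro y r t'
    simp [boxPair_fst_apply]
  ext x
  simp only [Set.mem_setOf_eq, Set.mem_inter_iff, Set.mem_Icc]
  constructor
  · rintro ⟨y, ⟨hyC, hypl⟩, r, ⟨hr0, hr1⟩, rfl⟩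
    have hyt : y t = if s then b t else a t := (mem_plane_boxPair a b t s y).1 hypl
    intro t'
    rw [hcoord]
    by_cases ht : t' = t
    · subst ht
      cases s <;> simp only [Bool.false_eq_true, if_false, if_true] at hyt ⊢ <;> rw [hyt] <;>
        constructor <;> linarith
    · simp only [ht, if_false, mul_zero, add_zero]
      exact hyC t'
  · intro hx
    -- the height above the face and the foot point
    set r : ℝ := if s then x t - b t else a t - x t with hr
    refine ⟨x - r • ((if s then (EuclideanSpace.single t (1 : ℝ), b t)
      else (-EuclideanSpace.single t (1 : ℝ), -a t)) :
        EuclideanSpace ℝ (Fin 3) × ℝ).1, ⟨?_, ?_⟩, r, ?_, by abel⟩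
    · intro t'
      have hc : (x - r • ((if s then (EuclideanSpace.single t (1 : ℝ), b t)
      else (-EuclideanSpace.single t (1 : ℝ), -a t)) :
        EuclideanSpace ℝ (Fin 3) × ℝ).1) t' =
          x t' - r * (if t' = t then (if s then 1 else -1) else 0) := by
        simp [boxPair_fst_apply]
      rw [hc]
      have hxt' := hx t'
      by_cases ht : t' = t
      · subst ht
        have h := hab t'
        cases s <;> simp only [Bool.false_eq_true, if_false, if_true] at hxt' hr ⊢ <;> rw [hr] <;>
          constructor <;> linarith
      · simp only [ht, if_false] at hxt' ⊢
        simpa using hxt'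
    · rw [mem_plane_boxPair]
      have hc : (x - r • ((if s then (EuclideanSpace.single t (1 : ℝ), b t)
      else (-EuclideanSpace.single t (1 : ℝ), -a t)) :
        EuclideanSpace ℝ (Fin 3) × ℝ).1) t = x t - r * (if s then 1 else -1) := by
        simp [boxPair_fst_apply]
      rw [hc, hr]
      cases s <;> simp
    · have hxt := hx t
      simp only [if_true] at hxt
      cases s <;> simp only [Bool.false_eq_true, if_false, if_true] at hxt hr ⊢ <;> rw [hr] <;>
        constructor <;> linarith

/-- the volume of a facet prism of the box: `Π_{t' ≠ t} (b_{t'} − a_{t'})`. [folklore] -/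
private theorem toReal_volume_prism_boxPair {a b : EuclideanSpace ℝ (Fin 3)} (hab : ∀ t, a t < b t)
    (t : Fin 3) (s : Bool) :
    (volume {x : EuclideanSpace ℝ (Fin 3) |
        ∃ y ∈ {x : EuclideanSpace ℝ (Fin 3) | ∀ t, a t ≤ x t ∧ x t ≤ b t} ∩
          {x | ⟪((if s then (EuclideanSpace.single t (1 : ℝ), b t)
      else (-EuclideanSpace.single t (1 : ℝ), -a t)) :
        EuclideanSpace ℝ (Fin 3) × ℝ).1, x⟫ = ((if s then (EuclideanSpace.single t (1 : ℝ), b t)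
      else (-EuclideanSpace.single t (1 : ℝ), -a t)) :
        EuclideanSpace ℝ (Fin 3) × ℝ).2},
        ∃ r ∈ Set.Icc (0 : ℝ) 1, x = y + r • ((if s then (EuclideanSpace.single t (1 : ℝ), b t)
      else (-EuclideanSpace.single t (1 : ℝ), -a t)) :
        EuclideanSpace ℝ (Fin 3) × ℝ).1}).toReal =
      ∏ t' ∈ Finset.univ.erase t, (b t' - a t') := by
  classical
  rw [prism_boxPair_eq hab t s, volume_setOf_forall_le_le_three]
  simp_rw [prismHi_sub_prismLo]
  rw [← Finset.mul_prod_erase Finset.univ _ (Finset.mem_univ t)]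
  simp only [if_true, ENNReal.ofReal_one, one_mul]
  rw [ENNReal.toReal_prod]
  refine Finset.prod_congr rfl fun t' ht' => ?_
  rw [Finset.mem_erase] at ht'
  rw [if_neg ht'.1, ENNReal.toReal_ofReal (sub_nonneg.2 (hab t').le)]

/-! ## The box formula -/

/-- **The anisotropic perimeter of an open axis-parallel box of `ℝ³`**: for a compact convex body
`K ∋ 0` and `a_t < b_t` (`t = 0, 1, 2`),
`P_K({x | ∀ t, a_t < x_t < b_t}) = Σ_t (h_K(e_t) + h_K(−e_t)) · Π_{t' ≠ t} (b_{t'} − a_{t'})`,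
`h_K(ν) = sup_{y ∈ K} ⟪y, ν⟫`, `e_t = EuclideanSpace.single t 1` — the facet formula for the six
faces
`x_t = b_t` (outer normal `e_t`) and `x_t = a_t` (outer normal `−e_t`), each of area
`Π_{t' ≠ t} (b_{t'} − a_{t'})`.  (By `anisotropicPerimeter_interior_eq_of_convex` /
`anisotropicPerimeter_closure_eq_of_convex` the closed or half-open box has the same `K`-perimeter.)
[cite: Maggi2012, (20.2) p. 258 and Remark 20.3; EvansGariepy2015, Thm 5.16 (Gauss–Green),
polyhedral case] -/
theorem anisotropicPerimeter_box {K : Set (EuclideanSpace ℝ (Fin 3))} (hKc : IsCompact K)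
    (hK : Convex ℝ K) (hK0 : (0 : EuclideanSpace ℝ (Fin 3)) ∈ K) {a b : EuclideanSpace ℝ (Fin 3)}
    (hab : ∀ t, a t < b t) :
    anisotropicPerimeter K {x : EuclideanSpace ℝ (Fin 3) | ∀ t, a t < x t ∧ x t < b t} =
      ENNReal.ofReal (∑ t : Fin 3,
        (sSup ((fun y : EuclideanSpace ℝ (Fin 3) => ⟪y, EuclideanSpace.single t (1 : ℝ)⟫) '' K) +
          sSup ((fun y : EuclideanSpace ℝ (Fin 3) => ⟪y, -EuclideanSpace.single t (1 : ℝ)⟫) '' K)) *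
        ∏ t' ∈ Finset.univ.erase t, (b t' - a t')) := by
  classical
  set H : Finset (EuclideanSpace ℝ (Fin 3) × ℝ) := Finset.univ.image
      (fun p : Fin 3 × Bool =>
        if p.2 then (EuclideanSpace.single p.1 (1 : ℝ), b p.1)
        else (-EuclideanSpace.single p.1 (1 : ℝ), -a p.1)) with hH
  have hO : (⋂ q ∈ H, {x : EuclideanSpace ℝ (Fin 3) | ⟪q.1, x⟫ < q.2}) =
      {x | ∀ t, a t < x t ∧ x t < b t} := iInter_boxPair_eq a b
  -- the box is nonempty (its centre) and bounded (inside the compact closed box)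
  have hne : ({x : EuclideanSpace ℝ (Fin 3) | ∀ t, a t < x t ∧ x t < b t}).Nonempty := by
    refine ⟨(2⁻¹ : ℝ) • (a + b), fun t => ?_⟩
    have h := hab t
    simp only [PiLp.smul_apply, PiLp.add_apply, smul_eq_mul]
    constructor <;> linarith
  have hbdd : Bornology.IsBounded (⋂ q ∈ H, {x : EuclideanSpace ℝ (Fin 3) | ⟪q.1, x⟫ < q.2}) := by
    rw [hO]
    have hc : IsCompact ((WithLp.toLp 2) '' Set.Icc (WithLp.ofLp a) (WithLp.ofLp b) :
        Set (EuclideanSpace ℝ (Fin 3))) :=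
      isCompact_Icc.image (PiLp.continuous_toLp 2 _)
    refine hc.isBounded.subset fun x hx =>
      ⟨WithLp.ofLp x, ⟨fun t => (hx t).1.le, fun t => (hx t).2.le⟩, WithLp.toLp_ofLp _ _⟩
  have hcl : closure {x : EuclideanSpace ℝ (Fin 3) | ∀ t, a t < x t ∧ x t < b t} =
      {x | ∀ t, a t ≤ x t ∧ x t ≤ b t} := by
    rw [← hO, closure_iInter_halfSpace_lt H Prod.fst Prod.snd (hO ▸ hne), iInter_boxPair_le_eq]
  have h1 : ∀ q ∈ H, ‖q.1‖ = 1 := by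
    simp only [hH, Finset.forall_mem_image]
    exact fun p _ => norm_boxPair_fst a b p
  have hd : ∀ q ∈ H, ∀ q' ∈ H, q ≠ q' →
      {x : EuclideanSpace ℝ (Fin 3) | ⟪q.1, x⟫ = q.2} ≠ {x | ⟪q'.1, x⟫ = q'.2} := by
    simp only [hH, Finset.forall_mem_image]
    intro p _ p' _ hne'
    exact plane_boxPair_ne hab fun h => hne' (by rw [h])
  have hA := anisotropicPerimeter_iInter_halfSpace_lt_eq_facetSum H hbdd h1 hd hKc hK hK0
  rw [hO] at hA
  rw [hA, hcl]
  congr 1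
  rw [hH, Finset.sum_image fun p _ p' _ h => boxPair_injective hab h, Fintype.sum_prod_type]
  refine Finset.sum_congr rfl fun t _ => ?_
  rw [Fintype.sum_bool, toReal_volume_prism_boxPair hab t true,
    toReal_volume_prism_boxPair hab t false]
  simp only [if_true, Bool.false_eq_true, if_false]
  ring

/-! ## Two boxes glued along a common face -/

/-- A coordinate plane `{x | x_t = c}` of `ℝ³` is Lebesgue-null.
[cite: EvansGariepy2015, Thm 5.16 (Gauss–Green) — plumbing] -/
theorem volume_setOf_apply_eq_zero_three (t : Fin 3) (c : ℝ) :
    volume {x : EuclideanSpace ℝ (Fin 3) | x t = c} = 0 := by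
  -- exhaust by the degenerate boxes `{x_t = c, |x_{t'}| ≤ n}`
  have hsub : {x : EuclideanSpace ℝ (Fin 3) | x t = c} ⊆
      ⋃ n : ℕ, {x : EuclideanSpace ℝ (Fin 3) | ∀ t', (if t' = t then c else -(n : ℝ)) ≤ x t' ∧
        x t' ≤ (if t' = t then c else (n : ℝ))} := by
    intro x hx
    obtain ⟨n, hn⟩ := exists_nat_ge ‖x‖
    refine Set.mem_iUnion.2 ⟨n, fun t' => ?_⟩
    by_cases ht : t' = t
    · subst ht
      have hx' : x t' = c := hx
      simp [hx']
    · simp only [ht, if_false]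
      have h := (abs_le.1 ((PiLp.norm_apply_le x t').trans hn))
      simpa [Real.norm_eq_abs] using h
  refine measure_mono_null hsub (measure_iUnion_null fun n => ?_)
  rw [volume_setOf_forall_le_le_three, Finset.prod_eq_zero (Finset.mem_univ t)]
  simp

/-- Two open boxes glued along the face `x_0 = b_0 = a'_0` (same extent in the coordinates `1, 2`)
fill the merged open box up to the null face. [cite: Maggi2012, Remark 20.3 p. 258 — plumbing] -/
theorem union_box_glued_ae_eq {a b a' b' : EuclideanSpace ℝ (Fin 3)} (hab : ∀ t, a t < b t)
    (hab' : ∀ t, a' t < b' t) (h0 : b 0 = a' 0) (h1 : a 1 = a' 1) (h1' : b 1 = b' 1)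
    (h2 : a 2 = a' 2) (h2' : b 2 = b' 2) :
    ({x : EuclideanSpace ℝ (Fin 3) | ∀ t, a t < x t ∧ x t < b t} ∪
        {x | ∀ t, a' t < x t ∧ x t < b' t} : Set (EuclideanSpace ℝ (Fin 3))) =ᵐ[volume]
      {x : EuclideanSpace ℝ (Fin 3) | ∀ t, a t < x t ∧ x t < b' t} := by
  have hsub : {x : EuclideanSpace ℝ (Fin 3) | ∀ t, a t < x t ∧ x t < b t} ∪
      {x | ∀ t, a' t < x t ∧ x t < b' t} ⊆ {x | ∀ t, a t < x t ∧ x t < b' t} := by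
    rintro x (hx | hx) t
    · refine ⟨(hx t).1, ?_⟩
      fin_cases t
      · exact (hx 0).2.trans_le (h0.le.trans (hab' 0).le)
      · simpa [← h1'] using (hx 1).2
      · simpa [← h2'] using (hx 2).2
    · refine ⟨?_, (hx t).2⟩
      fin_cases t
      · exact ((hab 0).trans_le h0.le).trans (hx 0).1
      · simpa [h1] using (hx 1).1
      · simpa [h2] using (hx 2).1
  have hdiff : {x : EuclideanSpace ℝ (Fin 3) | ∀ t, a t < x t ∧ x t < b' t} \
      ({x | ∀ t, a t < x t ∧ x t < b t} ∪ {x | ∀ t, a' t < x t ∧ x t < b' t}) ⊆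
        {x | x 0 = b 0} := by
    intro x ⟨hx, hnot⟩
    by_contra hne
    rcases lt_or_gt_of_ne hne with hlt | hgt
    · exact hnot (Or.inl fun t => by
        fin_cases t
        · exact ⟨(hx 0).1, hlt⟩
        · simpa [h1'] using hx 1
        · simpa [h2'] using hx 2)
    · exact hnot (Or.inr fun t => by
        fin_cases t
        · exact ⟨h0 ▸ hgt, (hx 0).2⟩
        · simpa [h1] using hx 1
        · simpa [h2] using hx 2)
  refine MeasureTheory.ae_eq_set.2 ⟨?_, ?_⟩
  · exact measure_mono_null (fun x hx => (hx.2 (hsub hx.1)).elim) measure_empty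
  · exact measure_mono_null hdiff (volume_setOf_apply_eq_zero_three 0 (b 0))

/-- **Two boxes glued along a common face have the `K`-perimeter of the merged box** (the common
face is null and interior to the union). [cite: Maggi2012, Remark 20.3 p. 258; (20.2)] -/
theorem anisotropicPerimeter_union_box_glued_eq (K : Set (EuclideanSpace ℝ (Fin 3)))
    {a b a' b' : EuclideanSpace ℝ (Fin 3)} (hab : ∀ t, a t < b t) (hab' : ∀ t, a' t < b' t)
    (h0 : b 0 = a' 0) (h1 : a 1 = a' 1) (h1' : b 1 = b' 1) (h2 : a 2 = a' 2) (h2' : b 2 = b' 2) :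
    anisotropicPerimeter K ({x : EuclideanSpace ℝ (Fin 3) | ∀ t, a t < x t ∧ x t < b t} ∪
        {x | ∀ t, a' t < x t ∧ x t < b' t}) =
      anisotropicPerimeter K {x : EuclideanSpace ℝ (Fin 3) | ∀ t, a t < x t ∧ x t < b' t} :=
  anisotropicPerimeter_congr_ae K (union_box_glued_ae_eq hab hab' h0 h1 h1' h2 h2')

/-- The support value `h_K(ν) = sup_{y ∈ K} ⟪y, ν⟫` of a compact `K ∋ 0` is nonnegative.
[cite: Maggi2012, (20.2) p. 258 — plumbing] -/
theorem sSup_inner_image_nonneg {K : Set (EuclideanSpace ℝ (Fin 3))} (hKc : IsCompact K)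
    (hK0 : (0 : EuclideanSpace ℝ (Fin 3)) ∈ K) (ν : EuclideanSpace ℝ (Fin 3)) :
    0 ≤ sSup ((fun y : EuclideanSpace ℝ (Fin 3) => ⟪y, ν⟫) '' K) :=
  le_csSup (hKc.image (continuous_id.inner continuous_const)).bddAbove ⟨0, hK0, by simp⟩

/-- **Two boxes glued along the face `x_0 = b_0`** (real form, the shape of the route's
`rung_perTwoBoxes`):
`P_K(box ∪ box') = P_K(box) + P_K(box') − (h_K(e_0) + h_K(−e_0))·(b_1−a_1)(b_2−a_2)`
— the glued face is counted once in each box and not at all in the union.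
[cite: Maggi2012, (20.2) p. 258 and Remark 20.3; EvansGariepy2015, Thm 5.16 (Gauss–Green),
polyhedral case] -/
theorem toReal_anisotropicPerimeter_union_box_glued {K : Set (EuclideanSpace ℝ (Fin 3))}
    (hKc : IsCompact K) (hK : Convex ℝ K) (hK0 : (0 : EuclideanSpace ℝ (Fin 3)) ∈ K)
    {a b a' b' : EuclideanSpace ℝ (Fin 3)} (hab : ∀ t, a t < b t) (hab' : ∀ t, a' t < b' t)
    (h0 : b 0 = a' 0) (h1 : a 1 = a' 1) (h1' : b 1 = b' 1) (h2 : a 2 = a' 2) (h2' : b 2 = b' 2) :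
    (anisotropicPerimeter K ({x : EuclideanSpace ℝ (Fin 3) | ∀ t, a t < x t ∧ x t < b t} ∪
        {x | ∀ t, a' t < x t ∧ x t < b' t})).toReal =
      (anisotropicPerimeter K {x : EuclideanSpace ℝ (Fin 3) | ∀ t, a t < x t ∧ x t < b t}).toReal +
        (anisotropicPerimeter K
          {x : EuclideanSpace ℝ (Fin 3) | ∀ t, a' t < x t ∧ x t < b' t}).toReal -
        (sSup ((fun y : EuclideanSpace ℝ (Fin 3) => ⟪y, EuclideanSpace.single 0 (1 : ℝ)⟫) '' K) +
          sSup ((fun y : EuclideanSpace ℝ (Fin 3) => ⟪y, -EuclideanSpace.single 0 (1 : ℝ)⟫) '' K)) *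
          ((b 1 - a 1) * (b 2 - a 2)) := by
  have hbb' : ∀ t, b t ≤ b' t := by
    intro t
    fin_cases t
    · exact h0.le.trans (hab' 0).le
    · exact h1'.le
    · exact h2'.le
  have hab'' : ∀ t, a t < b' t := fun t => (hab t).trans_le (hbb' t)
  -- nonnegativity of the facet sums
  have hnn : ∀ c d : EuclideanSpace ℝ (Fin 3), (∀ t, c t < d t) →
      0 ≤ ∑ t : Fin 3,
        (sSup ((fun y : EuclideanSpace ℝ (Fin 3) => ⟪y, EuclideanSpace.single t (1 : ℝ)⟫) '' K) +
          sSup ((fun y : EuclideanSpace ℝ (Fin 3) => ⟪y, -EuclideanSpace.single t (1 : ℝ)⟫) '' K)) *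
        ∏ t' ∈ Finset.univ.erase t, (d t' - c t') := by
    intro c d hcd
    refine Finset.sum_nonneg fun t _ => mul_nonneg (add_nonneg (sSup_inner_image_nonneg hKc hK0 _)
      (sSup_inner_image_nonneg hKc hK0 _)) (Finset.prod_nonneg fun t' _ => ?_)
    exact sub_nonneg.2 (hcd t').le
  rw [anisotropicPerimeter_union_box_glued_eq K hab hab' h0 h1 h1' h2 h2',
    anisotropicPerimeter_box hKc hK hK0 hab'', anisotropicPerimeter_box hKc hK hK0 hab,
    anisotropicPerimeter_box hKc hK hK0 hab', ENNReal.toReal_ofReal (hnn a b' hab''),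
    ENNReal.toReal_ofReal (hnn a b hab), ENNReal.toReal_ofReal (hnn a' b' hab')]
  have hE0 : (Finset.univ.erase (0 : Fin 3)) = {1, 2} := by decide
  have hE1 : (Finset.univ.erase (1 : Fin 3)) = {0, 2} := by decide
  have hE2 : (Finset.univ.erase (2 : Fin 3)) = {0, 1} := by decide
  simp only [Fin.sum_univ_three, hE0, hE1, hE2, Finset.prod_pair (show (1 : Fin 3) ≠ 2 by decide),
    Finset.prod_pair (show (0 : Fin 3) ≠ 2 by decide),
    Finset.prod_pair (show (0 : Fin 3) ≠ 1 by decide)]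
  rw [← h1, ← h1', ← h2, ← h2', ← h0]
  ring

end Literature.Analysis.Convexity

end
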